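import Summits.QuantumFields.BalabanUV.Beta.EriceRemainderEnclosureJointLetterProfile

/-!
# RemainderExplicitWindowKernelWitness — ROAD P3: THE WINDOW LETTER IS A KERNEL LETTER (file 2 of 4: the MODULATED harmonic transform
# `Tν(K) = Σ_{n<K} φ(n)μ_n∕(K − n)` of (E26)'s profile `μ_n = 1∕√(1 + ln(n+1))` by a log-Lipschitz modulation `φ ∈ [0, 1]` — its increments,
# its KERNEL functional — BOUNDED, with no window majorant assumed or implied; files 3–4 `…WindowKernelPeaks` ∕ `…WindowKernelFamily`)

Cell `pub-balaban`, BINDER row D4 «RemainderConst leaves for Bałaban's split» (owner lineage `b2b-balaban-beta-an4`; this file by co-owner #3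
lineage `b2b-balaban-beta-d4-p3`, road P3, generation 39), β-FLOW TEAM duty (1); FREEZE (0) honoured (def-free module in road P3's own
`RemainderExplicit*` series; no leaf, no interface, no Literature file).  SOURCE: [BalabanJaffe1986] Part III §4 p. 250 — nothing of it is
used or asserted here: this file is LETTER-LEVEL real analysis with no run and no step function.
THE OBJECTS (all VARIABLES with defining hypotheses, no `def`): (E26) file 2's profile `μ_n = 1∕√(1 + ln(n+1))` (`hμ`; its lemmas
`mu_pos_le_one`, `mu_sub_mem`, `one_le_logShift` BY NAME), a MODULATION `φ : ℕ → ℝ` with `0 ≤ φ ≤ 1` (`hφ`) and the LOG-LIPSCHITZ property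
`|φ(n) − φ(m)| ≤ Λ(ln(n+1) − ln(m+1))` for `m ≤ n` (`hΛ`), and the modulated harmonic transform `Tν(K) = Σ_{n<K} φ(n)μ_n∕(K − n)` (`hT`).
File 4 takes the two-loop errors `β_{n,2} − β₂ = β₀θ·φ(n)μ_n` and DEFINES the one-loop numbers by exact cancellation, `β_{j,0} − β₀ =
θ(Tν(j+1) − Tν(j))`, so that the one-loop defect is `P = θ·Tν` and the JOINT letter of (E26) holds identically; everything the records, (3.75),
the kernel letter N3-ker and the failure of the window letter N3-win need about `Tν` is proved HERE, for an abstract modulation.  At the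
trivial modulation `φ ≡ 1` (Λ = 0) the objects ARE (E26) file 2's (`φμ = μ`, `Tν = Tμ`) and BOTH letters hold for the same transform —
N3-win with (3, 1) by (E26)'s `window_F` + sandwich, N3-ker with W = 16 by `kernel_T_le` below; the modulation is exactly what separates the
two letters (files 3–4; d4-p2 g28's junction J-1, C-d4p2-115).
WHAT THIS FILE PROVES ([folklore]; 0 sorry, 0 `def`):
* §1 `Lambda_nonneg`, `nu_mem` (`0 ≤ φμ ≤ μ ≤ 1`), **`nu_sub_le`** (slow variation of φμ: `|φ(n)μ_n − φ(m)μ_m| ≤ (Λ + 1∕2)(ln(n+1) − ln(m+1))`).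
* §2 `sum_inv_mul_succ_eq` (`Σ_{n<j} 1∕((j − n)(j + 1 − n)) = 1 − 1∕(j+1)`), `T_facts` (`Tν(0) = 0`, `Tν ≥ 0`), `T_succ_sub` (the increment
  identity `Tν(j+1) − Tν(j) = φ(j)μ_j − Σ_{n<j} φ(n)μ_n∕((j − n)(j + 1 − n))`), **`abs_T_succ_sub_le`** (`|ΔTν(j)| ≤ (2Λ + 2)(1 + ln(j+1))∕(j+1)`),
  `abs_T_sub_T_le` (`|Tν(K) − Tν(n)| ≤ (2Λ + 2)(1 + ln K)(K − n)∕(n+1)`), `one_add_log_sq_le` (`(1 + ln K)² ≤ 4(K + 1)`),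
  **`kernel_T_le` — THE KERNEL LETTER: `Σ_{n<K} |Tν(K) − Tν(n)|∕(K − n)² ≤ 16(Λ + 1)` for every K**.
* file 3 `…WindowKernelPeaks`: troughs (bounded), plateaux (≍ √(ln K)) and the FAILURE of the window letter; file 4 the family on records.
HONEST FRAMING (BETA-SPEC §0.2, verbatim and binding). *"Discharging BetaPertH makes Bałaban's UV stability UNCONDITIONAL — a real
constructive-QFT result; it is NOT the continuum limit and NOT the Clay problem."*  THIS MODULE DISCHARGES NOTHING: a TOY transform for NOT-IN-PRINT
letters (N3-win ∕ N3-ker ∕ joint, declared); nothing of Bałaban's (1.22) or of Bałaban–Jaffe's β_n asserted, constructed or instantiated; row D4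
class UNCHANGED (critical-path width 0; instance 0∕1; D4 DISCHARGE NO DATE).  NOT [Balaban1987RG1] Theorem 2, NOT BetaPertH, NOT continuum, NOT
Clay.  HONEST DEPENDENCY: continuum YM on T⁴ ⇐ BetaPertH ∧ nine spine estimates (0/9 proved); BetaPertH ⇐ (D1) ∧ (D4) ∧ CAP+tail; G-an2-4
gates asym, D1 and NE2/3/4.
-/

noncomputable section

open Finset Real Filter Topology

namespace Summit.QuantumFields.BalabanUV.Beta.RemainderExplicitWindowKernelWitness

open Summit.QuantumFields.BalabanUV.Beta.EriceFlowEnclosureBareCouplingSums (sum_range_reflect_sub sum_Ico_reflect_sub)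
open Summit.QuantumFields.BalabanUV.Beta.RemainderExplicitLogRate (sum_range_inv_succ_eq_harmonic)
open Summit.QuantumFields.BalabanUV.Beta.EriceRemainderEnclosureDriftLogRun (log_natCast_sub_nonneg)
open Summit.QuantumFields.BalabanUV.Beta.EriceRemainderEnclosureJointLetterProfile (mu_pos_le_one mu_sub_mem one_le_logShift)

section transform

variable {μ φ T : ℕ → ℝ} {Λ : ℝ}
  (hμ : ∀ n : ℕ, μ n = 1 / Real.sqrt (1 + Real.log ((n : ℝ) + 1)))
  (hφ : ∀ n : ℕ, 0 ≤ φ n ∧ φ n ≤ 1)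
  (hΛ : ∀ m n : ℕ, m ≤ n → |φ n - φ m| ≤ Λ * (Real.log ((n : ℝ) + 1) - Real.log ((m : ℝ) + 1)))
  (hT : ∀ K : ℕ, T K = ∑ n ∈ range K, φ n * μ n / ((K : ℝ) - n))

/-! ## §1 The modulated profile `φ(n)μ_n` -/

include hΛ in
/-- The log-Lipschitz constant is nonnegative (test the hypothesis on the pair 0 ≤ 1, where `ln 2 − ln 1 > 0`). [folklore] -/
theorem Lambda_nonneg : 0 ≤ Λ := by
  have h := hΛ 0 1 (by norm_num)
  have h2 : 0 < Real.log (((1 : ℕ) : ℝ) + 1) - Real.log (((0 : ℕ) : ℝ) + 1) := by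
    norm_num; exact Real.log_pos (by norm_num)
  nlinarith [abs_nonneg (φ 1 - φ 0)]

include hμ hφ in
/-- `0 ≤ φ(n)μ_n ≤ μ_n ≤ 1`. [folklore] -/
theorem nu_mem (n : ℕ) : 0 ≤ φ n * μ n ∧ φ n * μ n ≤ μ n ∧ μ n ≤ 1 := by
  obtain ⟨hμ0, hμ1⟩ := mu_pos_le_one hμ n
  obtain ⟨hφ0, hφ1⟩ := hφ n
  exact ⟨mul_nonneg hφ0 hμ0.le, by nlinarith, hμ1⟩

include hμ hφ hΛ in
/-- **SLOW VARIATION OF THE MODULATED PROFILE**: for `m ≤ n`, `|φ(n)μ_n − φ(m)μ_m| ≤ (Λ + 1∕2)(ln(n+1) − ln(m+1))` — the split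
`φ(n)(μ_n − μ_m) + (φ(n) − φ(m))μ_m` with (E26) file 2's `mu_sub_mem` (`0 ≤ μ_m − μ_n ≤ (b − a)∕(2a√b) ≤ (b − a)∕2`) and `hΛ`. [folklore] -/
theorem nu_sub_le {m n : ℕ} (hmn : m ≤ n) :
    |φ n * μ n - φ m * μ m| ≤ (Λ + 1 / 2) * (Real.log ((n : ℝ) + 1) - Real.log ((m : ℝ) + 1)) := by
  obtain ⟨hd0, hd⟩ := mu_sub_mem hμ hmn
  obtain ⟨ha1, hab, hy1'⟩ := one_le_logShift hmn
  obtain ⟨hφn0, hφn1⟩ := hφ n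
  obtain ⟨hμm0, hμm1⟩ := mu_pos_le_one hμ m
  set a := 1 + Real.log ((m : ℝ) + 1) with ha
  set b := 1 + Real.log ((n : ℝ) + 1) with hb
  have hy1 : 1 ≤ Real.sqrt b := Real.one_le_sqrt.mpr (by linarith)
  have hba0 : 0 ≤ b - a := by linarith
  have hba : Real.log ((n : ℝ) + 1) - Real.log ((m : ℝ) + 1) = b - a := by rw [ha, hb]; ring
  rw [hba] at hd ⊢
  -- μ_m − μ_n ≤ (b − a)/2
  have hd' : μ m - μ n ≤ (b - a) / 2 := by
    refine hd.trans ?_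
    rw [div_le_div_iff₀ (by positivity) (by norm_num)]
    nlinarith [mul_le_mul ha1 hy1 zero_le_one (by linarith : (0 : ℝ) ≤ a)]
  have hφd := hΛ m n hmn
  rw [hba] at hφd
  have e : φ n * μ n - φ m * μ m = -(φ n * (μ m - μ n)) + (φ n - φ m) * μ m := by ring
  rw [e]
  calc |-(φ n * (μ m - μ n)) + (φ n - φ m) * μ m| ≤ |-(φ n * (μ m - μ n))| + |(φ n - φ m) * μ m| := abs_add_le _ _
    _ = φ n * (μ m - μ n) + |φ n - φ m| * μ m := by
        rw [abs_neg, abs_of_nonneg (mul_nonneg hφn0 hd0), abs_mul, abs_of_pos hμm0]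
    _ ≤ 1 * ((b - a) / 2) + Λ * (b - a) * 1 :=
        add_le_add (mul_le_mul hφn1 hd' hd0 zero_le_one) (mul_le_mul hφd hμm1 hμm0.le (le_trans (abs_nonneg _) hφd))
    _ = (Λ + 1 / 2) * (b - a) := by ring

/-! ## §2 The modulated harmonic transform: increments, windows, the kernel letter -/

/-- `Σ_{n<j} 1∕((j − n)(j + 1 − n)) = 1 − 1∕(j + 1)` (reflect to `Σ_{i<j} 1∕((i+1)(i+2))` and telescope). [folklore] -/
theorem sum_inv_mul_succ_eq (j : ℕ) :
    ∑ n ∈ range j, 1 / (((j : ℝ) - n) * ((j : ℝ) - n + 1)) = 1 - 1 / ((j : ℝ) + 1) := by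
  rw [sum_range_reflect_sub (fun x => 1 / (x * (x + 1))) j]
  induction j with
  | zero => simp
  | succ j ih =>
      rw [sum_range_succ, ih]
      push_cast
      field_simp
      ring

include hμ hφ hT in
/-- `Tν(0) = 0` and `Tν(K) ≥ 0`. [folklore] -/
theorem T_facts (K : ℕ) : T 0 = 0 ∧ 0 ≤ T K := by
  refine ⟨by simp [hT], ?_⟩
  rw [hT]
  refine sum_nonneg fun n hn => div_nonneg (nu_mem hμ hφ n).1 ?_
  have : (n : ℝ) + 1 ≤ K := by exact_mod_cast mem_range.mp hn
  linarith

include hT in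
/-- **THE INCREMENT IDENTITY**: `Tν(j+1) − Tν(j) = φ(j)μ_j − Σ_{n<j} φ(n)μ_n∕((j − n)(j + 1 − n))`. [folklore] -/
theorem T_succ_sub (j : ℕ) :
    T (j + 1) - T j = φ j * μ j - ∑ n ∈ range j, φ n * μ n / (((j : ℝ) - n) * ((j : ℝ) - n + 1)) := by
  rw [hT, hT, sum_range_succ]
  push_cast
  have e1 : φ j * μ j / ((j : ℝ) + 1 - j) = φ j * μ j := by
    have : (j : ℝ) + 1 - j = 1 := by ring
    rw [this, div_one]
  rw [e1]
  have e2 : ∀ n ∈ range j, φ n * μ n / ((j : ℝ) + 1 - n) - φ n * μ n / ((j : ℝ) - n) =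
      -(φ n * μ n / (((j : ℝ) - n) * ((j : ℝ) - n + 1))) := by
    intro n hn
    have hjn : (0 : ℝ) < (j : ℝ) - n := by
      have : (n : ℝ) + 1 ≤ j := by exact_mod_cast mem_range.mp hn
      linarith
    have h1 : (j : ℝ) - n ≠ 0 := ne_of_gt hjn
    have h2 : (j : ℝ) + 1 - n ≠ 0 := ne_of_gt (by linarith)
    have h3 : (j : ℝ) - n + 1 ≠ 0 := ne_of_gt (by linarith)
    field_simp
    ring
  have e3 : ∑ n ∈ range j, φ n * μ n / ((j : ℝ) + 1 - n) - ∑ n ∈ range j, φ n * μ n / ((j : ℝ) - n) =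
      -∑ n ∈ range j, φ n * μ n / (((j : ℝ) - n) * ((j : ℝ) - n + 1)) := by
    rw [← sum_sub_distrib, ← sum_neg_distrib]
    exact sum_congr rfl e2
  linarith [e3]

include hμ hφ hΛ hT in
/-- **THE INCREMENTS ARE O(ln j ∕ j)**: `|Tν(j+1) − Tν(j)| ≤ (2Λ + 2)(1 + ln(j+1))∕(j+1)`.  Write the increment as
`φ(j)μ_j∕(j+1) − Σ_{n<j} (φ(n)μ_n − φ(j)μ_j)∕((j − n)(j + 1 − n))` (§2's closed form); by §1 and `ln((j+1)∕(n+1)) ≤ (j − n)∕(n+1)` each summand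
is at most `(Λ + 1∕2)∕((n+1)(j + 1 − n)) = ((Λ + 1∕2)∕(j+2))·(1∕(n+1) + 1∕(j + 1 − n))`, and both harmonic pieces are ≤ `1 + ln j`. [folklore] -/
theorem abs_T_succ_sub_le (j : ℕ) :
    |T (j + 1) - T j| ≤ (2 * Λ + 2) * (1 + Real.log ((j : ℝ) + 1)) / ((j : ℝ) + 1) := by
  have hΛ0 := Lambda_nonneg hΛ
  have hj0 : (0 : ℝ) < (j : ℝ) + 1 := by positivity
  have hlog0 : 0 ≤ Real.log ((j : ℝ) + 1) := Real.log_nonneg (by linarith [(Nat.cast_nonneg j : (0 : ℝ) ≤ j)])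
  have hlogj : Real.log (j : ℝ) ≤ Real.log ((j : ℝ) + 1) := by
    rcases Nat.eq_zero_or_pos j with hz | hp
    · rw [hz]; simp
    · exact Real.log_le_log (by exact_mod_cast hp) (by linarith)
  obtain ⟨hν0, hνμ, hμ1⟩ := nu_mem hμ hφ j
  -- harmonic pieces
  have hH : ∑ n ∈ range j, 1 / ((n : ℝ) + 1) ≤ 1 + Real.log ((j : ℝ) + 1) := by
    rw [sum_range_inv_succ_eq_harmonic]; exact (harmonic_le_one_add_log j).trans (by linarith)
  have hH' : ∑ n ∈ range j, 1 / ((j : ℝ) - n + 1) ≤ 1 + Real.log ((j : ℝ) + 1) := by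
    rw [sum_range_reflect_sub (fun x => 1 / (x + 1)) j]
    refine le_trans (sum_le_sum fun i _ => ?_) hH
    exact one_div_le_one_div_of_le (by positivity) (by linarith)
  -- the correction sum
  have hcorr : |∑ n ∈ range j, (φ n * μ n - φ j * μ j) / (((j : ℝ) - n) * ((j : ℝ) - n + 1))| ≤
      (Λ + 1 / 2) / ((j : ℝ) + 2) * (2 * (1 + Real.log ((j : ℝ) + 1))) := by
    calc _ ≤ ∑ n ∈ range j, |(φ n * μ n - φ j * μ j) / (((j : ℝ) - n) * ((j : ℝ) - n + 1))| := abs_sum_le_sum_abs _ _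
      _ ≤ ∑ n ∈ range j, (Λ + 1 / 2) / ((j : ℝ) + 2) * (1 / ((n : ℝ) + 1) + 1 / ((j : ℝ) - n + 1)) := by
          refine sum_le_sum fun n hn => ?_
          have hnj := mem_range.mp hn
          have hm : (1 : ℝ) ≤ (j : ℝ) - n := by
            have : (n : ℝ) + 1 ≤ j := by exact_mod_cast hnj
            linarith
          have hn0 : (0 : ℝ) < (n : ℝ) + 1 := by positivity
          have hden : (0 : ℝ) < ((j : ℝ) - n) * ((j : ℝ) - n + 1) := by positivity
          rw [abs_div, abs_of_pos hden, abs_sub_comm]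
          have h1 := nu_sub_le hμ hφ hΛ hnj.le
          -- ln((j+1)/(n+1)) ≤ (j − n)/(n+1)
          have hlog : Real.log ((j : ℝ) + 1) - Real.log ((n : ℝ) + 1) ≤ ((j : ℝ) - n) / ((n : ℝ) + 1) := by
            rw [← Real.log_div (by positivity) hn0.ne']
            have h := Real.log_le_sub_one_of_pos (show (0 : ℝ) < ((j : ℝ) + 1) / ((n : ℝ) + 1) by positivity)
            have e : ((j : ℝ) + 1) / ((n : ℝ) + 1) - 1 = ((j : ℝ) - n) / ((n : ℝ) + 1) := by field_simp; ring
            linarith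
          have hΛ' : 0 ≤ Λ + 1 / 2 := by linarith
          calc |φ j * μ j - φ n * μ n| / (((j : ℝ) - n) * ((j : ℝ) - n + 1))
              ≤ (Λ + 1 / 2) * (((j : ℝ) - n) / ((n : ℝ) + 1)) / (((j : ℝ) - n) * ((j : ℝ) - n + 1)) :=
                div_le_div_of_nonneg_right (h1.trans (mul_le_mul_of_nonneg_left hlog hΛ')) hden.le
            _ = (Λ + 1 / 2) / ((j : ℝ) + 2) * (1 / ((n : ℝ) + 1) + 1 / ((j : ℝ) - n + 1)) := by
                field_simp
                ring
      _ = (Λ + 1 / 2) / ((j : ℝ) + 2) * (∑ n ∈ range j, 1 / ((n : ℝ) + 1) + ∑ n ∈ range j, 1 / ((j : ℝ) - n + 1)) := by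
          rw [← mul_sum, sum_add_distrib]
      _ ≤ (Λ + 1 / 2) / ((j : ℝ) + 2) * (2 * (1 + Real.log ((j : ℝ) + 1))) :=
          mul_le_mul_of_nonneg_left (by linarith) (by positivity)
  -- assemble
  have hid : T (j + 1) - T j = φ j * μ j / ((j : ℝ) + 1) -
      ∑ n ∈ range j, (φ n * μ n - φ j * μ j) / (((j : ℝ) - n) * ((j : ℝ) - n + 1)) := by
    rw [T_succ_sub hT j]
    have e : ∑ n ∈ range j, (φ n * μ n - φ j * μ j) / (((j : ℝ) - n) * ((j : ℝ) - n + 1)) =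
        ∑ n ∈ range j, φ n * μ n / (((j : ℝ) - n) * ((j : ℝ) - n + 1)) -
          φ j * μ j * ∑ n ∈ range j, 1 / (((j : ℝ) - n) * ((j : ℝ) - n + 1)) := by
      rw [mul_sum, ← sum_sub_distrib]
      exact sum_congr rfl fun n _ => by ring
    rw [e, sum_inv_mul_succ_eq]
    ring
  rw [hid]
  have hfirst : |φ j * μ j / ((j : ℝ) + 1)| ≤ 1 / ((j : ℝ) + 1) := by
    rw [abs_div, abs_of_pos hj0, abs_of_nonneg hν0]
    exact div_le_div_of_nonneg_right (hνμ.trans hμ1) hj0.le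
  calc _ ≤ |φ j * μ j / ((j : ℝ) + 1)| + |∑ n ∈ range j, (φ n * μ n - φ j * μ j) / (((j : ℝ) - n) * ((j : ℝ) - n + 1))| :=
        abs_sub _ _
    _ ≤ 1 / ((j : ℝ) + 1) + (Λ + 1 / 2) / ((j : ℝ) + 2) * (2 * (1 + Real.log ((j : ℝ) + 1))) := add_le_add hfirst hcorr
    _ ≤ 1 / ((j : ℝ) + 1) + (Λ + 1 / 2) / ((j : ℝ) + 1) * (2 * (1 + Real.log ((j : ℝ) + 1))) := by
        have hΛ' : 0 ≤ Λ + 1 / 2 := by linarith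
        have h1 : (Λ + 1 / 2) / ((j : ℝ) + 2) ≤ (Λ + 1 / 2) / ((j : ℝ) + 1) :=
          div_le_div_of_nonneg_left hΛ' hj0 (by linarith)
        have h2 : 0 ≤ 2 * (1 + Real.log ((j : ℝ) + 1)) := by positivity
        linarith [mul_le_mul_of_nonneg_right h1 h2]
    _ = (1 + (2 * Λ + 1) * (1 + Real.log ((j : ℝ) + 1))) / ((j : ℝ) + 1) := by ring
    _ ≤ (2 * Λ + 2) * (1 + Real.log ((j : ℝ) + 1)) / ((j : ℝ) + 1) := by
        apply div_le_div_of_nonneg_right _ hj0.le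
        nlinarith

include hμ hφ hΛ hT in
/-- **WINDOW INCREMENTS, SUMMED**: for `n ≤ K`, `|Tν(K) − Tν(n)| ≤ (2Λ + 2)(1 + ln K)(K − n)∕(n+1)` (telescope §2's increment bound over
`n ≤ i < K`, where `1∕(i+1) ≤ 1∕(n+1)` and `ln(i+1) ≤ ln K`). [folklore] -/
theorem abs_T_sub_T_le {n K : ℕ} (hn : n ≤ K) :
    |T K - T n| ≤ (2 * Λ + 2) * (1 + Real.log (K : ℝ)) * (((K : ℝ) - n) / ((n : ℝ) + 1)) := by
  have hΛ0 := Lambda_nonneg hΛ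
  have htel : T K - T n = ∑ i ∈ Ico n K, (T (i + 1) - T i) := by
    rw [Finset.sum_Ico_eq_sub _ hn, Finset.sum_range_sub, Finset.sum_range_sub]; ring
  have hn0 : (0 : ℝ) < (n : ℝ) + 1 := by positivity
  have hcard : ((Ico n K).card : ℝ) = (K : ℝ) - n := by rw [Nat.card_Ico, Nat.cast_sub hn]
  have hterm : ∀ i ∈ Ico n K, |T (i + 1) - T i| ≤ (2 * Λ + 2) * (1 + Real.log (K : ℝ)) / ((n : ℝ) + 1) := by
    intro i hi
    obtain ⟨hni, hiK⟩ := Finset.mem_Ico.mp hi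
    have hi1 : (i : ℝ) + 1 ≤ K := by exact_mod_cast hiK
    have hlog : Real.log ((i : ℝ) + 1) ≤ Real.log (K : ℝ) := Real.log_le_log (by positivity) hi1
    have hlog0 : 0 ≤ Real.log ((i : ℝ) + 1) := Real.log_nonneg (by linarith [(Nat.cast_nonneg i : (0 : ℝ) ≤ i)])
    have hni' : (n : ℝ) + 1 ≤ (i : ℝ) + 1 := by exact_mod_cast Nat.add_le_add_right hni 1
    calc |T (i + 1) - T i| ≤ (2 * Λ + 2) * (1 + Real.log ((i : ℝ) + 1)) / ((i : ℝ) + 1) := abs_T_succ_sub_le hμ hφ hΛ hT i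
      _ ≤ (2 * Λ + 2) * (1 + Real.log (K : ℝ)) / ((n : ℝ) + 1) := by
          gcongr
  rw [htel]
  calc |∑ i ∈ Ico n K, (T (i + 1) - T i)| ≤ ∑ i ∈ Ico n K, |T (i + 1) - T i| := abs_sum_le_sum_abs _ _
    _ ≤ (Ico n K).card • ((2 * Λ + 2) * (1 + Real.log (K : ℝ)) / ((n : ℝ) + 1)) := Finset.sum_le_card_nsmul _ _ _ hterm
    _ = _ := by rw [nsmul_eq_mul, hcard]; ring

/-- `(1 + ln K)² ≤ 4(K + 1)` for every natural K (`ln K = 2 ln √K ≤ 2(√K − 1)` for `K ≥ 1`; `ln 0 = 0`). [folklore] -/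
theorem one_add_log_sq_le (K : ℕ) : (1 + Real.log (K : ℝ)) ^ 2 ≤ 4 * ((K : ℝ) + 1) := by
  rcases Nat.eq_zero_or_pos K with hz | hp
  · rw [hz]; norm_num
  have hK1 : (1 : ℝ) ≤ K := by exact_mod_cast hp
  have hs1 : 1 ≤ Real.sqrt K := Real.one_le_sqrt.mpr hK1
  have hs2 : Real.sqrt (K : ℝ) ^ 2 = K := Real.sq_sqrt (by linarith)
  have hlog : Real.log (K : ℝ) ≤ 2 * (Real.sqrt K - 1) := by
    have h := Real.log_le_sub_one_of_pos (by linarith : (0 : ℝ) < Real.sqrt K)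
    have e : Real.log (Real.sqrt (K : ℝ)) = Real.log K / 2 := Real.log_sqrt (by linarith)
    linarith
  have hlog0 : 0 ≤ Real.log (K : ℝ) := Real.log_nonneg hK1
  nlinarith

include hμ hφ hΛ hT in
/-- **THE KERNEL LETTER FOR THE MODULATED TRANSFORM**: `Σ_{n<K} |Tν(K) − Tν(n)|∕(K − n)² ≤ 16(Λ + 1)` for every K — the window bound of
`abs_T_sub_T_le` against the kernel gives `(2Λ + 2)(1 + ln K)·Σ_{n<K} 1∕((n+1)(K − n)) = (2Λ + 2)(1 + ln K)·2H_K∕(K + 1) ≤ 2(2Λ + 2)(1 + ln K)²∕(K + 1)`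
and `(1 + ln K)² ≤ 4(K + 1)`.  (The functional even tends to 0; only boundedness is used.) [folklore] -/
theorem kernel_T_le (K : ℕ) : ∑ n ∈ range K, |T K - T n| / ((K : ℝ) - n) ^ 2 ≤ 16 * (Λ + 1) := by
  have hΛ0 := Lambda_nonneg hΛ
  have hK0 : (0 : ℝ) < (K : ℝ) + 1 := by positivity
  have hlog0 : 0 ≤ Real.log (K : ℝ) := Real.log_natCast_nonneg K
  set c := (2 * Λ + 2) * (1 + Real.log (K : ℝ)) with hc
  have hc0 : 0 ≤ c := by positivity
  have hH : ∑ n ∈ range K, 1 / ((n : ℝ) + 1) ≤ 1 + Real.log (K : ℝ) := by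
    rw [sum_range_inv_succ_eq_harmonic]; exact harmonic_le_one_add_log K
  have hH' : ∑ n ∈ range K, 1 / ((K : ℝ) - n) ≤ 1 + Real.log (K : ℝ) := by
    rw [sum_range_reflect_sub (fun x => 1 / x) K]; exact hH
  calc ∑ n ∈ range K, |T K - T n| / ((K : ℝ) - n) ^ 2
      ≤ ∑ n ∈ range K, c / ((K : ℝ) + 1) * (1 / ((n : ℝ) + 1) + 1 / ((K : ℝ) - n)) := by
        refine sum_le_sum fun n hn => ?_
        have hnK := mem_range.mp hn
        have hm : (1 : ℝ) ≤ (K : ℝ) - n := by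
          have : (n : ℝ) + 1 ≤ K := by exact_mod_cast hnK
          linarith
        have hn0 : (0 : ℝ) < (n : ℝ) + 1 := by positivity
        have h := abs_T_sub_T_le hμ hφ hΛ hT hnK.le
        rw [← hc] at h
        calc |T K - T n| / ((K : ℝ) - n) ^ 2 ≤ c * (((K : ℝ) - n) / ((n : ℝ) + 1)) / ((K : ℝ) - n) ^ 2 :=
              div_le_div_of_nonneg_right h (by positivity)
          _ = c / ((K : ℝ) + 1) * (1 / ((n : ℝ) + 1) + 1 / ((K : ℝ) - n)) := by
              field_simp
              ring
    _ = c / ((K : ℝ) + 1) * (∑ n ∈ range K, 1 / ((n : ℝ) + 1) + ∑ n ∈ range K, 1 / ((K : ℝ) - n)) := by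
        rw [← mul_sum, sum_add_distrib]
    _ ≤ c / ((K : ℝ) + 1) * (2 * (1 + Real.log (K : ℝ))) := mul_le_mul_of_nonneg_left (by linarith) (by positivity)
    _ = 2 * (2 * Λ + 2) * (1 + Real.log (K : ℝ)) ^ 2 / ((K : ℝ) + 1) := by rw [hc]; ring
    _ ≤ 2 * (2 * Λ + 2) * (4 * ((K : ℝ) + 1)) / ((K : ℝ) + 1) :=
        div_le_div_of_nonneg_right (mul_le_mul_of_nonneg_left (one_add_log_sq_le K) (by positivity)) hK0.le
    _ = 16 * (Λ + 1) := by field_simp; ring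

end transform

end Summit.QuantumFields.BalabanUV.Beta.RemainderExplicitWindowKernelWitness

end
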